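import Summits.CriticalPhenomena.PercolationContinuityZ3.Theorems.PercNearOneGluingNoHeavyQuantSiblingStep
import Summits.CriticalPhenomena.PercolationContinuityZ3.Theorems.PercNearOneGluingNoHeavyQuantForestData
import HarnessLib

/-!
# QUANT lane R8, T-DEC: THE BRIDGE between the node binder (`CompForestN`) and the data-level list binder (`List Sib`) —
# `SiblingStep ⟺ its list form`, and the atomic regime of the sibling step discharged on lists

builds on p205010 (kernel theorem, internal audit signed; external expert review pending)

Support + definition file (`--supports stmt-CriticalPhenomena-4575`), QUANT lane typer seat prim-quant-stmt (gen 39), rung R8 of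
`run/shared/lean/prim/quant/LADDER.md`.  Two `Prop`/ℕ-valued definitions (`Sib.TreeOK`, `fgates`); theorems with standard axioms, no sorries.
Joins typer g39's `…QuantSiblingStep` (✓ p396424: `CompForestN`, `SiblingStep`) with `…QuantForestData` (✓ p396899: `Sib`, `flaw`, `ftop`).

WHY.  Certificate families are stated over sibling DATA (`qᵢ, Mᵢ, ρᵢ, …`, any width) — `List Sib`; the node of record quantifies over the
inductive certificate `CompForestN`.  This file proves they are the same binder:

* `Sib.TreeOK x s` — tree-built validity of a sibling at floor `x` (`0 < q < 1`, `x ≤ q·x₁`, `TreeBuiltN x₁ n M ρ`, `ρ` not a point mass);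
  `fgates L = Σ (nᵢ + 1)`; `Sib.TreeOK.lawOK`.
* `compForestN_of_list` (`∀ s ∈ L, s.TreeOK x` ⟹ `CompForestN x (fgates L) (ftop L) (flaw L) L.length`) and `exists_list_of_compForestN`
  (every `CompForestN x n M μ k` is `flaw L` for such a list with `fgates L = n`, `ftop L = M`, `L.length = k`);
* **`siblingStep_iff_list`**: `SiblingStep ↔ ∀ x L, 0 < x → x < 1 → (∀ s ∈ L, s.TreeOK x) → 3 ≤ L.length → (oracle below fgates L) →
  SDEC x (ftop L) (flaw L)` — the node of record in the data binder;
* consequence (not restated here, to keep the import chain short): with `…QuantAtomicRegating`, for such lists with root relays the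
  ATOMIC REGIME of the node's conclusion holds outright — `sdecUpTo_flaw_atomic L (fun s hs => (hL s hs).lawOK) h0 hx0 hfl :
  SDECUpTo x (sigmaR L / fmean L) (ftop L) (flaw L)` (no oracle needed).

HONEST STATUS: `SiblingStep`, `GateStepN`, `FarTreeRow` OPEN (large outer gates); RATE class log\* / honest sentence unchanged.
[this work].  Nothing here is cited as a published result.  The gluing rows served [cite: KozmaNitzan2024, Conjecture 3 (p. 15)]; product
measure [cite: Grimmett1999, §1.3 p. 10].
-/

noncomputable section

namespace Summit.CriticalPhenomena.PercolationContinuityZ3.Theorems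
namespace Quant
namespace LawDec

/-- **tree-built validity of sibling data at floor `x`**: `0 < q < 1`, `x ≤ q·x₁`, the sub-forest law is tree-built (`TreeBuiltN x₁ n M ρ`) and
not a point mass. [this work] -/
def Sib.TreeOK (x : ℝ) (s : Sib) : Prop :=
  0 < s.q ∧ s.q < 1 ∧ x ≤ s.q * s.x₁ ∧ TreeBuiltN s.x₁ s.n s.M s.ρ ∧ ∀ K : ℕ, s.ρ ≠ fun h => if h = K then (1 : ℝ) else 0

/-- the number of nontrivial gates of a sibling list: `Σ (nᵢ + 1)`. [this work] -/
def fgates : List Sib → ℕ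
  | [] => 0
  | s :: L => fgates L + (s.n + 1)

/-- tree-built validity implies law-level validity. [this work] -/
theorem Sib.TreeOK.lawOK {x : ℝ} {s : Sib} (h : s.TreeOK x) : s.LawOK := by
  obtain ⟨hq0, hq1, _, hT, _⟩ := h
  obtain ⟨_, _, ρ0, ρM, ρ1, _⟩ := hT.lawFacts
  exact ⟨hq0, hq1, ρ0, ρM, ρ1⟩

/-- **list ⟹ node binder**: a list of tree-built composite siblings at floor `x` is a `CompForestN` forest. [this work] -/
theorem compForestN_of_list {x : ℝ} (hx0 : 0 < x) (hx1 : x < 1) :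
    ∀ L : List Sib, (∀ s ∈ L, s.TreeOK x) → CompForestN x (fgates L) (ftop L) (flaw L) L.length
  | [], _ => CompForestN.nil x hx0 hx1
  | s :: L, hL => by
    obtain ⟨hq0, hq1, hxq, hT, hnp⟩ := hL s List.mem_cons_self
    exact CompForestN.tree (compForestN_of_list hx0 hx1 L fun t ht => hL t (List.mem_cons_of_mem s ht)) s.q hq0 hq1 hxq hT hnp

/-- **node binder ⟹ list**: every `CompForestN` forest is the forest law of a list of tree-built composite siblings with the same gate
count, top and width. [this work] -/
theorem exists_list_of_compForestN {x : ℝ} {n M k : ℕ} {μ : ℕ → ℝ} (hF : CompForestN x n M μ k) :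
    ∃ L : List Sib, (∀ s ∈ L, s.TreeOK x) ∧ fgates L = n ∧ ftop L = M ∧ flaw L = μ ∧ L.length = k := by
  induction hF with
  | nil hx0 hx1 => exact ⟨[], fun s hs => by simp at hs, rfl, rfl, rfl, rfl⟩
  | @tree n₀ M₀ k₀ μ₀ _ x₁ n₁ M₁ ρ q hq0 hq1 hxq hρ hnp ih =>
    obtain ⟨L, hL, hn, hM, hμ, hk⟩ := ih
    refine ⟨⟨q, x₁, n₁, M₁, ρ⟩ :: L, fun s hs => ?_, by simp [fgates, hn], by simp [ftop, hM], by simp [flaw, hM, hμ], by simp [hk]⟩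
    rcases List.mem_cons.1 hs with rfl | hs
    · exact ⟨hq0, hq1, hxq, hρ, hnp⟩
    · exact hL s hs

/-- **THE NODE OF RECORD IN THE DATA BINDER**: `SiblingStep` is equivalent to its list form. [this work] -/
theorem siblingStep_iff_list :
    SiblingStep ↔ ∀ (x : ℝ) (L : List Sib), 0 < x → x < 1 → (∀ s ∈ L, s.TreeOK x) → 3 ≤ L.length →
      (∀ (x' : ℝ) (n' M' : ℕ) (μ' : ℕ → ℝ), n' < fgates L → TreeBuiltN x' n' M' μ' → SDEC x' M' μ') →
      SDEC x (ftop L) (flaw L) := by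
  constructor
  · intro hS x L hx0 hx1 hL hk hO
    exact hS x (fgates L) (ftop L) L.length (flaw L) hk (compForestN_of_list hx0 hx1 L hL) hO
  · intro h x n M k μ hk hF hO
    obtain ⟨L, hL, hn, hM, hμ, hkL⟩ := exists_list_of_compForestN hF
    subst hn hM hμ hkL
    exact h x L hF.floor.1 hF.floor.2 hL hk hO

end LawDec
end Quant
end Summit.CriticalPhenomena.PercolationContinuityZ3.Theorems
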